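import Mathlib
import HarnessLib
import Summits.QuantumFields.Statement
import Summits.QuantumFields.YangMills.Theses.ConvexGribovBody

/-! Split-glue preview (crux-strategist): the k = 2 momentum split of `CovarianceBound` in the ROUTE FILE's own
vocabulary (no Theorems import needed), and its glue. -/

namespace Summit.QuantumFields.YangMills.Theses.ConvexGribovBody

open scoped BigOperators Topology Manifold Classical MeasureTheory ProbabilityTheory Matrix InnerProductSpace ComplexConjugate ContinuousMap
open Filter Set Function TopologicalSpace MeasureTheory

/-- child 1 (p = 0): the crux's body at zero spatial momentum only. -/
def CovarianceBoundZero : Prop :=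
  ∀ (G : Type) [Group G] [TopologicalSpace G] [IsTopologicalGroup G] [CompactSpace G] [MeasurableSpace G] [BorelSpace G], Literature.MathematicalPhysics.QuantumFieldTheory.IsCompactSimpleLieGroup G → ∀ r : Literature.MathematicalPhysics.QuantumFieldTheory.LatticeRep G, ∃ β₀ : ℝ, ∀ β : ℝ, β₀ ≤ β → ∃ D : ℝ, 0 < D ∧ ∃ S₀ : ℕ, ∀ S : ℕ, S₀ ≤ S → let μ := Literature.MathematicalPhysics.QuantumFieldTheory.wilsonMeasure (d := 4) (L := 2 * S + 1) r.ρ β; let fro : Matrix (Fin r.N) (Fin r.N) ℂ → ℝ := fun M => ∑ a, ∑ b, ‖M a b‖ ^ 2; let coul : Literature.MathematicalPhysics.QuantumFieldTheory.GaugeConfig 4 (2 * S + 1) G → (Literature.MathematicalPhysics.QuantumFieldTheory.Site 4 (2 * S + 1) → G) → ℝ := fun U h => -∑ e : Literature.MathematicalPhysics.QuantumFieldTheory.Edge 4 (2 * S + 1), (if e.1 0 = 0 ∧ e.2 ≠ 0 then (r.ρ (Literature.MathematicalPhysics.QuantumFieldTheory.gaugeTransform h U e)).trace.re else 0); let cov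 : Literature.MathematicalPhysics.QuantumFieldTheory.GaugeConfig 4 (2 * S + 1) G → (Literature.MathematicalPhysics.QuantumFieldTheory.Site 4 (2 * S + 1) → G) → (Fin 3 → ZMod (2 * S + 1)) → ℝ := fun U h p => (∑ j : Fin 3, fro (∑ y : Fin 3 → ZMod (2 * S + 1), Complex.exp (-(2 * Real.pi * Complex.I * (∑ i : Fin 3, ((p i).val : ℂ) * ((y i).val : ℂ)) / (2 * S + 1 : ℂ))) • ((1 / 2 : ℂ) • (r.ρ (Literature.MathematicalPhysics.QuantumFieldTheory.gaugeTransform h U (Fin.cons (0 : ZMod (2 * S + 1)) y, j.succ)) - (r.ρ (Literature.MathematicalPhysics.QuantumFieldTheory.gaugeTransform h U (Fin.cons (0 : ZMod (2 * S + 1)) y, j.succ)))ᴴ)))) / ((2 * S + 1 : ℝ) ^ 3); ∫ U, (⨆ h : {h : Literature.MathematicalPhysics.QuantumFieldTheory.Site 4 (2 * S + 1) → G // ∀ h', coul U h ≤ coul U h'}, cov U h.1 0) ∂μ ≤ D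

/-- child 2 (p ≠ 0): the crux's body at every non-zero spatial momentum. -/
def CovarianceBoundPos : Prop :=
  ∀ (G : Type) [Group G] [TopologicalSpace G] [IsTopologicalGroup G] [CompactSpace G] [MeasurableSpace G] [BorelSpace G], Literature.MathematicalPhysics.QuantumFieldTheory.IsCompactSimpleLieGroup G → ∀ r : Literature.MathematicalPhysics.QuantumFieldTheory.LatticeRep G, ∃ β₀ : ℝ, ∀ β : ℝ, β₀ ≤ β → ∃ D : ℝ, 0 < D ∧ ∃ S₀ : ℕ, ∀ S : ℕ, S₀ ≤ S → let μ := Literature.MathematicalPhysics.QuantumFieldTheory.wilsonMeasure (d := 4) (L := 2 * S + 1) r.ρ β; let fro : Matrix (Fin r.N) (Fin r.N) ℂ → ℝ := fun M => ∑ a, ∑ b, ‖M a b‖ ^ 2; let coul : Literature.MathematicalPhysics.QuantumFieldTheory.GaugeConfig 4 (2 * S + 1) G → (Literature.MathematicalPhysics.QuantumFieldTheory.Site 4 (2 * S + 1) → G) → ℝ := fun U h => -∑ e : Literature.MathematicalPhysics.QuantumFieldTheory.Edge 4 (2 * S + 1), (if e.1 0 = 0 ∧ e.2 ≠ 0 then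 (r.ρ (Literature.MathematicalPhysics.QuantumFieldTheory.gaugeTransform h U e)).trace.re else 0); let cov : Literature.MathematicalPhysics.QuantumFieldTheory.GaugeConfig 4 (2 * S + 1) G → (Literature.MathematicalPhysics.QuantumFieldTheory.Site 4 (2 * S + 1) → G) → (Fin 3 → ZMod (2 * S + 1)) → ℝ := fun U h p => (∑ j : Fin 3, fro (∑ y : Fin 3 → ZMod (2 * S + 1), Complex.exp (-(2 * Real.pi * Complex.I * (∑ i : Fin 3, ((p i).val : ℂ) * ((y i).val : ℂ)) / (2 * S + 1 : ℂ))) • ((1 / 2 : ℂ) • (r.ρ (Literature.MathematicalPhysics.QuantumFieldTheory.gaugeTransform h U (Fin.cons (0 : ZMod (2 * S + 1)) y, j.succ)) - (r.ρ (Literature.MathematicalPhysics.QuantumFieldTheory.gaugeTransform h U (Fin.cons (0 : ZMod (2 * S + 1)) y, j.succ)))ᴴ)))) / ((2 * S + 1 : ℝ) ^ 3); ∀ p : Fin 3 → ZMod (2 * S + 1), p ≠ 0 → ∫ U, (⨆ h : {h : Literature.MathematicalPhysics.QuantumFieldTheory.Site 4 (2 * S + 1) → G // ∀ h', coul U h ≤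 coul U h'}, cov U h.1 p) ∂μ ≤ D

/-- glue `C₁ → C₂ → C` (pure logic: `β₀ = max`, `D = max`, `S₀ = max`, case split on `p = 0`). -/
theorem covarianceBound_of_zero_pos : CovarianceBoundZero → CovarianceBoundPos → CovarianceBound := by
  intro h0 h1 G _ _ _ _ _ _ hG r
  obtain ⟨β₁, hβ₁⟩ := h0 G hG r
  obtain ⟨β₂, hβ₂⟩ := h1 G hG r
  refine ⟨max β₁ β₂, fun β hβ => ?_⟩
  obtain ⟨D₁, hD₁, S₁, hS₁⟩ := hβ₁ β (le_trans (le_max_left _ _) hβ)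
  obtain ⟨D₂, hD₂, S₂, hS₂⟩ := hβ₂ β (le_trans (le_max_right _ _) hβ)
  refine ⟨max D₁ D₂, lt_max_of_lt_left hD₁, max S₁ S₂, fun S hS => ?_⟩
  intro μ fro coul cov p
  by_cases hp : p = 0
  · subst hp
    exact le_trans (hS₁ S (le_trans (le_max_left _ _) hS)) (le_max_left _ _)
  · exact le_trans (hS₂ S (le_trans (le_max_right _ _) hS) p hp) (le_max_right _ _)

/-- converse (restriction), so the split is exact. -/
theorem zero_pos_of_covarianceBound : CovarianceBound → CovarianceBoundZero ∧ CovarianceBoundPos := by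
  intro h
  refine ⟨fun G _ _ _ _ _ _ hG r => ?_, fun G _ _ _ _ _ _ hG r => ?_⟩
  · obtain ⟨β₀, hβ₀⟩ := h G hG r
    refine ⟨β₀, fun β hβ => ?_⟩
    obtain ⟨D, hD, S₀, hS₀⟩ := hβ₀ β hβ
    exact ⟨D, hD, S₀, fun S hS => hS₀ S hS 0⟩
  · obtain ⟨β₀, hβ₀⟩ := h G hG r
    refine ⟨β₀, fun β hβ => ?_⟩
    obtain ⟨D, hD, S₀, hS₀⟩ := hβ₀ β hβ
    exact ⟨D, hD, S₀, fun S hS p _ => hS₀ S hS p⟩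

end Summit.QuantumFields.YangMills.Theses.ConvexGribovBody
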